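import Summits.QuantumFields.GaugeBoot.FluctuationWick
import Summits.QuantumFields.GaugeBoot.FluctuationLimit
import HarnessLib

/-!
# Fluctuations of Wilson loops, XIX: GAUSSIAN fluctuations — Wick's theorem in the 't Hooft limit (gauge-boot, ADDENDUM 33, headline)

HONEST FRAMING (cell `pub-gaugeboot`, page 1 of every file): the venture produces certified bounds
on lattice expectations at stated coupling, gauge group, dimension and torus size; NOT a mass gap,
NOT a continuum limit, NOT a string tension; NOT Yang–Mills-summit-bearing (barriers
`FixedCouplingUltralocality`, `PerturbativeInvisibility`).  Strong-coupling `SO(N)` lattice gauge theory with free boundary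
condition (S. Chatterjee, Comm. Math. Phys. **366** (2019); S. Chatterjee, J. Jafarov, arXiv:1604.04777); nothing about
four-dimensional continuum Yang–Mills or a mass gap.

## Content — THE WILSON LOOPS OF STRONGLY COUPLED `SO(N)` LATTICE GAUGE THEORY ARE ASYMPTOTICALLY JOINTLY GAUSSIAN

`wilsonLoop_wick_limit` (★★★): for `d ≥ 2` and every `n` there is `β_G(d, n) > 0` such that for `|β| ≤ β_G` there are a
BLOCK COVARIANCE `κ_β(A, B)` on loop sequences and its WICK FUNCTIONAL `W_β` (`W(∅) = 1`,
`W(C, rest) = Σ_i κ(C, rest_i) W(rest ∖ i)` — the hafnian, i.e. the sum over perfect matchings of the product of covariances)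
with: `κ_β([l], [l']) = f₄(l,l') − f₄(l)f₀(l') − f₂(l)f₂(l') − f₀(l)f₄(l')`; `κ_β(A, B) = lim N² ⟨(W_A/N^{|A|} − φ(A))(W_B/N^{|B|} − φ(B))⟩`;
and for every `log`-admissible `Λ_N` and genuine loops `l₁, …, l_m` (`m ≤ n`)

  `⟨∏_{i ≤ m} (W_{l_i} − ⟨W_{l_i}⟩)⟩_{Λ_N, N, β} ⟶ W_β([l₁], …, [l_m]) = Σ_{pairings} ∏ κ_β([l_a], [l_b])`,

more generally `N^m ⟨(W_{B₀}/N^{|B₀|}) ∏_{j ≤ m} (W_{C_j}/N^{|C_j|} − φ(C_j))⟩ ⟶ f₀(B₀) · W_β(C₁, …, C_m)`.  So the centered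
Wilson loop variables converge JOINTLY IN MOMENTS TO THE CENTERED GAUSSIAN FIELD with covariance `κ_β` (and are asymptotically
independent of the normalised uncentered products, which become deterministic).  Assembly of parts A–D with ADDENDUM 32.

Not claimed: convergence in distribution is not spelled out (only all mixed moments); nothing at fixed `N`.
-/

noncomputable section

open Finset Filter Topology PowerSeries MeasureTheory
open Literature.Probability.LatticeModels (Site box)
open Literature.MathematicalPhysics.QuantumFieldTheory.Chatterjee2019LargeN

namespace Summit.QuantumFields.GaugeBoot

namespace StringDuality

variable {d : ℕ}

/-- The hafnian on the full position set satisfies the familiar list recursion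
`W(C, rest) = Σ_i κ(C, rest_i) · W(rest ∖ i)`. [folklore] -/
theorem hafnian_list_recursion {α : Type*} {κ : α → α → ℝ} {dflt : α} {Hf : List α → Finset ℕ → ℝ}
    (h0 : ∀ Cs : List α, Hf Cs ∅ = 1)
    (hS : ∀ (Cs : List α) (S : Finset ℕ) (h : S.Nonempty), Hf Cs S =
      ∑ i ∈ S.erase (S.min' h), κ (Cs.getD (S.min' h) dflt) (Cs.getD i dflt) * Hf Cs ((S.erase (S.min' h)).erase i))
    (C : α) (rest : List α) :
    Hf (C :: rest) (Finset.range (rest.length + 1)) =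
      ∑ i ∈ Finset.range rest.length, κ C (rest.getD i dflt) * Hf (rest.eraseIdx i) (Finset.range (rest.eraseIdx i).length) := by
  classical
  rw [hafnian_peel hS (C :: rest) (Finset.range (rest.length + 1)) (a := 0) (by simp) (fun y _ => Nat.zero_le y)]
  have himg : (Finset.range (rest.length + 1)).erase 0 = (Finset.range rest.length).image Nat.succ := by
    ext k
    simp only [Finset.mem_erase, Finset.mem_range, Finset.mem_image, Nat.succ_eq_add_one]
    constructor
    · rintro ⟨hk0, hk⟩; exact ⟨k - 1, by omega, by omega⟩
    · rintro ⟨a, ha, rfl⟩; exact ⟨by omega, by omega⟩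
  rw [himg, Finset.sum_image fun x _ y _ h => Nat.succ_injective h]
  refine Finset.sum_congr rfl fun i hi => ?_
  have hi' : i < rest.length := Finset.mem_range.mp hi
  rw [Nat.succ_eq_add_one, List.getD_cons_zero, List.getD_cons_succ, ← Finset.image_erase Nat.succ_injective,
    ← hafnian_relabel h0 hS (strictMono_nat_of_lt_succ fun k => Nat.lt_succ_self _) _ rest (C :: rest) (fun k _ => (List.getD_cons_succ).symm),
    List.length_eraseIdx_of_lt hi', hafnian_eraseIdx h0 hS rest (show i ≤ rest.length - 1 by omega),
    show rest.length - 1 + 1 = rest.length by omega]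

/-- ★★★ **WICK'S THEOREM FOR WILSON LOOPS IN THE STRONGLY COUPLED 'T HOOFT LIMIT.**  See the module docstring: clause 1 pins
`F` as THE `1/N` expansion family (orders `≤ n + 2`); for `|β| ≤ β_G` there are the block covariance `κ` (clause 2: its value on
single loops in the `1/N` coefficients; clause 3: it IS the limiting rescaled covariance of normalised block variables) and its
Wick functional `W` (clauses 4–5: hafnian recursion) such that (6) the rescaled centered block moments converge to
`f₀(B₀) · W(C₁..C_m)` and (7) `⟨∏_{i≤m}(W_{l_i} − ⟨W_{l_i}⟩)⟩_{Λ_N,N,β} → W([l₁]..[l_m])` (`m ≤ n`). [new (lane)] -/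
theorem wilsonLoop_wick_limit (hd : 2 ≤ d) (n : ℕ) :
    ∃ βG : ℝ, 0 < βG ∧ ∃ F : ℕ → ℝ → LoopSeq d → ℝ,
      (∀ k, k ≤ n + 2 → ∀ β : ℝ, |β| ≤ βG → ∀ s : LoopSeq d, IsLoopSeq s →
        Tendsto (fun N : ℕ => (N : ℝ) ^ k *
          (phi N β (box d N) s - ∑ i ∈ Finset.range k, F (i + 2) β s / (N : ℝ) ^ i)) atTop (𝓝 (F (k + 2) β s))) ∧
      ∀ β : ℝ, |β| ≤ βG → ∃ κ : LoopSeq d → LoopSeq d → ℝ, ∃ W : List (LoopSeq d) → ℝ,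
        (∀ l l' : List (DEdge d), κ [l] [l'] =
          F 4 β [l, l'] - F 4 β [l] * F 2 β [l'] - F 3 β [l] * F 3 β [l'] - F 2 β [l] * F 4 β [l']) ∧
        (∀ M : ℕ → ℕ, (∀ a : ℕ, ∀ᶠ N : ℕ in atTop, a * Nat.log 2 N ≤ M N) →
          ∀ A B : LoopSeq d, IsLoopSeq A → IsLoopSeq B →
            Tendsto (fun N : ℕ => (N : ℝ) ^ 2 * soExpect N β (box d (M N)) (fun U =>
              (wilsonProd N A U / (N : ℝ) ^ A.length - phi N β (box d (M N)) A) *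
                (wilsonProd N B U / (N : ℝ) ^ B.length - phi N β (box d (M N)) B))) atTop (𝓝 (κ A B))) ∧
        W [] = 1 ∧
        (∀ (C : LoopSeq d) (rest : List (LoopSeq d)),
          W (C :: rest) = ∑ i ∈ Finset.range rest.length, κ C (rest.getD i []) * W (rest.eraseIdx i)) ∧
        (∀ M : ℕ → ℕ, (∀ a : ℕ, ∀ᶠ N : ℕ in atTop, a * Nat.log 2 N ≤ M N) →
          ∀ (B₀ : LoopSeq d) (Cs : List (LoopSeq d)), IsLoopSeq B₀ → (∀ C ∈ Cs, IsLoopSeq C) → Cs.length ≤ n →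
            Tendsto (fun N : ℕ => (N : ℝ) ^ Cs.length * soExpect N β (box d (M N)) (fun U =>
              wilsonProd N B₀ U / (N : ℝ) ^ B₀.length *
                (Cs.map fun C => wilsonProd N C U / (N : ℝ) ^ C.length - phi N β (box d (M N)) C).prod)) atTop
              (𝓝 (F 2 β B₀ * W Cs))) ∧
        (∀ M : ℕ → ℕ, (∀ a : ℕ, ∀ᶠ N : ℕ in atTop, a * Nat.log 2 N ≤ M N) →
          ∀ ls : LoopSeq d, IsLoopSeq ls → ls.length ≤ n →
            Tendsto (fun N : ℕ => soExpect N β (box d (M N)) (fun U =>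
              (ls.map fun l => wilsonLoopVar N l U - soExpect N β (box d (M N)) (wilsonLoopVar N l)).prod)) atTop
              (𝓝 (W (ls.map fun l => [l])))) := by
  obtain ⟨β₀, hpos, hanti, C, L, hC, hL, F, hF0, hF1, HA, -, -⟩ := oneOverN_master d hd
  obtain ⟨K, hKdef⟩ : ∃ K : ℕ, K = n + 2 := ⟨_, rfl⟩
  have hmono : Antitone β₀ := antitone_nat_of_succ_le hanti
  -- ### constants
  set Cc : ℝ := 1 + ∑ j ∈ Finset.range (K + 1), C j with hCc
  set Lc : ℝ := ∑ j ∈ Finset.range (K + 1), L j with hLc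
  have hCsum : 0 ≤ ∑ j ∈ Finset.range (K + 1), C j := Finset.sum_nonneg fun j _ => hC j
  have hCc1 : 1 ≤ Cc := by rw [hCc]; linarith
  have hCj : ∀ j, j ≤ K → C j ≤ Cc := fun j hj => by
    have h := Finset.single_le_sum (f := C) (fun i _ => hC i) (Finset.mem_range.mpr (Nat.lt_succ_of_le hj))
    rw [hCc]; linarith
  have hLj : ∀ j, j ≤ K → L j ≤ Lc := fun j hj => by
    rw [hLc]
    exact Finset.single_le_sum (f := L) (fun i _ => zero_le_one.trans (hL i)) (Finset.mem_range.mpr (Nat.lt_succ_of_le hj))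
  have hLc1 : 1 ≤ Lc := (hL 0).trans (hLj 0 (Nat.zero_le K))
  set βG : ℝ := min (β₀ K) (1 / (4096 * ((d : ℝ) + 1) * (((1 + (K + 1) * Cc) * Lc) ^ 2 + 4) ^ 4)) with hβG
  have hβGpos : 0 < βG := lt_min (hpos K) (by positivity)
  refine ⟨βG, hβGpos, F, fun k hk β hβ s hs =>
    (HA k β (hβ.trans ((min_le_left _ _).trans (hmono (show k ≤ K by omega))))).2.2.2.2.1 s hs, ?_⟩
  intro β hβ
  have hbk : ∀ k, k ≤ K → |β| ≤ β₀ k := fun k hk => hβ.trans ((min_le_left _ _).trans (hmono hk))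
  have hβc : |β| ≤ 1 / (4096 * ((d : ℝ) + 1) * (((1 + (K + 1) * Cc) * Lc) ^ 2 + 4) ^ 4) := hβ.trans (min_le_right _ _)
  -- ### the facts at orders `≤ n`
  have hnil : ∀ k, k ≤ K → F (k + 2) β [] = if k = 0 then 1 else 0 := fun k hk => (HA k β (hbk k hk)).1
  have hbd : ∀ j, j ≤ K → ∀ u : LoopSeq d, IsLoopSeq u → |F (j + 2) β u| ≤ Cc * Lc ^ u.len := by
    intro j hj u hu
    refine ((HA j β (hbk j hj)).2.1 u hu).trans ?_
    exact mul_le_mul (hCj j hj) (pow_le_pow_left₀ (zero_le_one.trans (hL j)) (hLj j hj) _)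
      (pow_nonneg (zero_le_one.trans (hL j)) _) (by linarith [hCj j hj, hC j])
  have hrec : ∀ k, k ≤ K → ∀ s : LoopSeq d, IsLoopSeq s → s ≠ [] →
      (s.len : ℝ) * F (k + 2) β s -
          ((∑ o : InvIdx s, F (k + 2) β (s.negSplitAt o)) - (∑ o : SameIdx s, F (k + 2) β (s.posSplitAt o))
            + β * (∑ o : DeformIdx s, F (k + 2) β (s.negDeformAt o))
            - β * (∑ o : DeformIdx s, F (k + 2) β (s.posDeformAt o))) =
        (s.len : ℝ) * F (k + 1) β s
          + ((∑ o : SameIdx s, F (k + 1) β (s.negTwistAt o)) - ∑ o : InvIdx s, F (k + 1) β (s.posTwistAt o))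
          + ((∑ o : MergeIdx s, F k β (s.negMergeAt o)) - ∑ o : MergeIdx s, F k β (s.posMergeAt o)) :=
    fun k hk => (HA k β (hbk k hk)).2.2.1
  have hexpN : ∀ k, k ≤ K → ∀ s : LoopSeq d, IsLoopSeq s →
      Tendsto (fun N : ℕ => (N : ℝ) ^ k *
        (phi N β (box d N) s - ∑ i ∈ Finset.range k, F (i + 2) β s / (N : ℝ) ^ i)) atTop (𝓝 (F (k + 2) β s)) :=
    fun k hk => (HA k β (hbk k hk)).2.2.2.2.1
  have hperm := expansion_coeff_perm hexpN
  -- ### the power-series data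
  obtain ⟨P, hPdef⟩ : ∃ P : LoopSeq d → PowerSeries ℝ, ∀ u, P u = PowerSeries.mk fun k => F (k + 2) β u := ⟨_, fun _ => rfl⟩
  have hP : ∀ (u : LoopSeq d) (k : ℕ), coeff k (P u) = F (k + 2) β u := fun u k => by rw [hPdef, coeff_mk]
  obtain ⟨G, hG0, hGs⟩ := centered_exists (R := PowerSeries ℝ) P
  have hvan := centered_coeff_vanish hCc1 hLc1 (hF0 β) (hF1 β) hrec hperm hnil hbd hβc P hP hG0 hGs
  -- ### the general moment clause
  have hmom : ∀ M : ℕ → ℕ, (∀ a : ℕ, ∀ᶠ N : ℕ in atTop, a * Nat.log 2 N ≤ M N) →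
      ∀ (B₀ : LoopSeq d) (Cs : List (LoopSeq d)), IsLoopSeq B₀ → (∀ C ∈ Cs, IsLoopSeq C) → Cs.length ≤ K →
        Tendsto (fun N : ℕ => (N : ℝ) ^ Cs.length * soExpect N β (box d (M N)) (fun U =>
          wilsonProd N B₀ U / (N : ℝ) ^ B₀.length *
            (Cs.map fun C => wilsonProd N C U / (N : ℝ) ^ C.length - phi N β (box d (M N)) C).prod)) atTop
          (𝓝 (coeff Cs.length (G B₀ Cs))) := by
    intro M hM B₀ Cs hB₀ hCs hlen
    choose GN hGN0 hGNs using fun N : ℕ => centered_exists (R := ℝ) (fun u : LoopSeq d => phi N β (box d (M N)) u)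
    have hexp : ∀ u : LoopSeq d, IsLoopSeq u →
        Tendsto (fun N : ℕ => (N : ℝ) ^ K * (phi N β (box d (M N)) u - (trunc (K + 1) (P u)).eval ((1 : ℝ) / N)))
          atTop (𝓝 0) := by
      intro u hu
      rw [hPdef]
      exact hasExp_of_expansion (c := fun i => F (i + 2) β u) ((HA K β (hbk K le_rfl)).2.2.2.1 M hM u hu)
    have h := centered_tendsto_leading (pN := fun N u => phi N β (box d (M N)) u) hexp hGN0 hGNs hG0 hGs hvan
      B₀ Cs hB₀ hCs hlen
    refine h.congr fun N => ?_
    rw [centeredN_eq_soExpect N β (box d (M N)) (hGN0 N) (hGNs N) Cs B₀]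
  -- ### the Wick data
  obtain ⟨κ, hκ⟩ : ∃ κ : LoopSeq d → LoopSeq d → ℝ, ∀ A B, κ A B = coeff 2 (G [] [A, B]) := ⟨_, fun _ _ => rfl⟩
  obtain ⟨Hf, hH0, hHS⟩ := hafnian_exists κ ([] : LoopSeq d)
  have hK2 : 2 ≤ K := by omega
  have hwick := centered_coeff_wick hCc1 hLc1 (hF0 β) (hF1 β) hrec hperm hnil hbd hβc P hP hG0 hGs hK2 κ hκ hH0 hHS
  have hnilS : IsLoopSeq ([] : LoopSeq d) := fun l hl => by simp at hl
  obtain ⟨W, hW⟩ : ∃ W : List (LoopSeq d) → ℝ, ∀ Cs, W Cs = Hf Cs (Finset.range Cs.length) := ⟨_, fun _ => rfl⟩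
  refine ⟨κ, W, ?_, ?_, by rw [hW, List.length_nil, Finset.range_zero, hH0], ?_, ?_, ?_⟩
  · -- the covariance of single loops
    intro l l'
    have hlow : ∀ j, j ≤ 2 → coeff j (P [l'] * P []) = coeff j (P [l']) := by
      intro j hj
      rw [PowerSeries.coeff_mul, Finset.sum_eq_single (j, 0)]
      · rw [hP [] 0, hnil 0 (by omega), if_pos rfl, mul_one]
      · intro q hq hne
        have hq' : q.1 + q.2 = j := Finset.HasAntidiagonal.mem_antidiagonal.mp hq
        have hq2 : q.2 ≠ 0 := fun h => hne (by ext <;> simp <;> omega)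
        rw [hP [] q.2, hnil q.2 (by omega), if_neg hq2, mul_zero]
      · intro h; exact absurd (Finset.HasAntidiagonal.mem_antidiagonal.mpr (by simp)) h
    have hz : coeff 2 (P [l] * (P [l'] - P [l'] * P [])) = 0 := by
      rw [PowerSeries.coeff_mul]
      refine Finset.sum_eq_zero fun q hq => ?_
      have hq' : q.1 + q.2 = 2 := Finset.HasAntidiagonal.mem_antidiagonal.mp hq
      rw [map_sub, hlow q.2 (by omega), sub_self, mul_zero]
    have hprod : coeff 2 (P [l'] * P [l]) = F 2 β [l'] * F 4 β [l] + F 3 β [l'] * F 3 β [l] + F 4 β [l'] * F 2 β [l] := by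
      rw [PowerSeries.coeff_mul, Finset.Nat.sum_antidiagonal_eq_sum_range_succ_mk]
      simp only [Finset.sum_range_succ, Finset.sum_range_zero, zero_add, hP]
    have e : ([l] ++ [l'] : LoopSeq d) = [l, l'] := rfl
    rw [hκ]
    simp only [hGs, hG0, List.nil_append, e]
    rw [map_sub, map_sub, hz, sub_zero, hprod, hP]
    ring
  · -- the covariance as a limit
    intro M hM A B hA hB
    have hCs : ∀ C ∈ [A, B], IsLoopSeq C := by
      intro C hC
      simp only [List.mem_cons, List.mem_nil_iff, or_false] at hC
      rcases hC with rfl | rfl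
      · exact hA
      · exact hB
    have h := hmom M hM [] [A, B] hnilS hCs (by simp only [List.length_cons, List.length_nil]; omega)
    have hW2 : coeff 2 (G [] [A, B]) = κ A B := (hκ A B).symm
    simp only [List.length_cons, List.length_nil, zero_add] at h
    rw [show (0 + 1 + 1 : ℕ) = 2 from rfl] at h
    rw [← hW2]
    refine h.congr fun N => ?_
    congr 1
    unfold soExpect
    refine integral_congr_ae (Eventually.of_forall fun U => ?_)
    simp [wilsonProd]
  · -- the hafnian recursion
    intro C rest
    rw [hW, List.length_cons, hafnian_list_recursion hH0 hHS C rest]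
    exact Finset.sum_congr rfl fun i _ => by rw [hW]
  · -- general block moments, with Wick's formula
    intro M hM B₀ Cs hB₀ hCs hlen
    rw [hW, ← hwick Cs.length (by omega) B₀ Cs hB₀ hCs rfl]
    exact hmom M hM B₀ Cs hB₀ hCs (by omega)
  · -- the Wilson loop form
    intro M hM ls hls hlen
    have hCs : ∀ C ∈ ls.map (fun l => [l]), IsLoopSeq C := by
      intro C hC
      obtain ⟨l, hl, rfl⟩ := List.mem_map.mp hC
      exact fun w hw => by rw [List.mem_singleton.mp hw]; exact hls l hl
    have h := hmom M hM [] (ls.map fun l => [l]) hnilS hCs (by rw [List.length_map]; omega)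
    rw [hwick _ (by rw [List.length_map]; omega) [] _ hnilS hCs rfl, hnil 0 (Nat.zero_le K), if_pos rfl, one_mul,
      List.length_map] at h
    rw [hW, List.length_map]
    refine h.congr' ?_
    filter_upwards [eventually_gt_atTop 0] with N hN
    have hN : (N : ℝ) ≠ 0 := by exact_mod_cast hN.ne'
    have hφ : ∀ l : List (DEdge d), soExpect N β (box d (M N)) (wilsonLoopVar N l) = (N : ℝ) * phi N β (box d (M N)) [l] := by
      intro l
      have hw : wilsonProd N [l] = wilsonLoopVar N l := by funext U; simp [wilsonProd]
      unfold phi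
      rw [hw, List.length_singleton, pow_one, mul_div_cancel₀ _ hN]
    have hfun : (fun U =>
        (ls.map fun l => wilsonLoopVar N l U - soExpect N β (box d (M N)) (wilsonLoopVar N l)).prod) =
        fun U => (N : ℝ) ^ ls.length * (wilsonProd N [] U / (N : ℝ) ^ ([] : LoopSeq d).length *
          ((ls.map fun l => [l]).map fun C => wilsonProd N C U / (N : ℝ) ^ C.length - phi N β (box d (M N)) C).prod) := by
      funext U
      have h1 : wilsonProd N [] U / (N : ℝ) ^ ([] : LoopSeq d).length = 1 := by simp [wilsonProd]
      rw [h1, one_mul, List.map_map, ← prod_map_const_mul]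
      congr 1
      refine List.map_congr_left fun l _ => ?_
      have hw : wilsonProd N [l] U = wilsonLoopVar N l U := by simp [wilsonProd]
      simp only [Function.comp_apply, List.length_singleton, pow_one, hw, hφ l]
      rw [mul_sub, mul_div_cancel₀ _ hN]
    rw [hfun]
    unfold soExpect
    rw [integral_const_mul]

end StringDuality

end Summit.QuantumFields.GaugeBoot

end
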